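import Literature.IUT.HodgeArakelov.CohomologyLimitConj
import Literature.AnabelianGeometry.EtaleTheta.KummerContH1Conj
import Literature.AnabelianGeometry.EtaleTheta.KummerContH1Kernel

/-!
# The Kummer map of the constants INTO the genuine cohomology limit `lim_K H¹(H|_K, A')`
# ([IUTchII] Prop. 3.1 (ii) "`Ψ_cns(M^Θ_*) := M_TM(M^Θ_*) ⊆ lim_J H¹(Π_Ÿ(M^Θ_*)|_J, Π_μ(M^Θ_*))`";
# Cor. 1.12 (c) "`M^×_TM(Π) ↪ lim_J H¹(J, (l·Δ_Θ)(Π))`"), along a change of coefficient cyclotome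
abc-iut cell, D-0067 wave 4 (seat abc-iut-w4-d007; layer L6; GAP-LEDGER row **G-w4d019-1**, its last open
part). S. Mochizuki, *Inter-universal Teichmüller theory II*, kurims manuscript (Dec. 2020):
* Prop. 3.1 (ii) p. 88 (ll. 2–17): "By applying the cyclotomic rigidity isomorphisms of Corollaries 2.8, (i);
  2.9, … [elision: the `Z ⊆ Ẑ` clause via Remark 1.11.5, (i)] one obtains a functorial algorithm
  `M^Θ_* ↦ Ψ_cns(M^Θ_*) := M_TM(M^Θ_*) ⊆ lim_J H¹(Π_Ÿ(M^Θ_*)|_J, Π_μ(M^Θ_*))` [where J is as in (i)]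
  for constructing a 'monoid of constants' — i.e., which is naturally isomorphic to `O^▷_{F̄_v}` [cf. Example
  1.8, (ii)] — equipped with a natural conjugation action by `Π_X(M^Θ_*)`" ("[where J is as in (i)]" is print's);
* Cor. 1.12 (c) p. 56 (ll. 25–29), VERBATIM: "we recall that it follows from the definitions [cf. Example 1.8,
  (ii), (iii); [AbsTopIII], Definition 3.1, (vi); [IUTchI], Remark 3.1.2] that one has a natural inclusion
  `M^×_TM(Π) ↪ lim_J H¹(J, (l·Δ_Θ)(Π))`, hence a natural inclusion of `M^×_TM(Π)` into the inductive limit of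
  the first line" [= `lim_J H¹(Π_Ÿ(M^Θ_*(Π))|_J, Π_μ(M^Θ_*(Π)))` of the display of Cor. 1.12 (ii)].
  OUR GLOSS, not print's wording (repair of referee finding P-D3-F1, abc-iut-ref-p, 2026-08-26): this file
  realises that "natural inclusion" as the Kummer map of `M^×_TM(Π)` with coefficients changed along the
  composite of [the inverse of] Cor. 1.11 (a) p. 49 "`μ_Ẑ(G) ⥲ μ_Ẑ(O^×(G))`" with Cor. 1.11 (b) p. 49
  "`μ_Ẑ(G) ⥲ (l·Δ_Θ)(Π)`"; print attributes the inclusion to "the definitions" and names no Kummer map here.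
Claim key `Mochizuki2012` (D-0012, DISPUTED): the interface this file instantiates is the author's; the
CONSTRUCTION below is classical Kummer theory ([cite: NeukirchSchmidtWingberg2008, I §5];
[cite: LANA2026Report, §6.1 p.31]) over landed files; nothing here takes a side on [IUTchIII] Cor. 3.12.
WHAT WAS MISSING (G-w4d019-1 after p412666 … p414302: Kummer map into the DISCRETE colimit over Mathlib
`groupCohomology.H1`, comparison `φ` with the `θ`-side left as a datum): the `θ`-side ambient module is
abc-iut-L6-t1's GENUINE limit `h1Lim φ A' H ⊥ = lim_K H¹(H ⊓ K, A')` of L2's CONTINUOUS `ContH1` (p411226) with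
the conjugation action `h1LimConj` (abc-iut-w4-d043); here the Kummer map is built DIRECTLY into that limit.
DATA: a topological group `Π = P`; coefficients `A' ≤ G'` abelian normal with `Π` acting by conjugation through
`φ : Π → G'` (at the model: `(l·Δ_Θ)(Π)`, resp. `Π_μ(M^Θ_*)`); a subgroup `H ≤ Π` (`⊤` for Cor. 1.12 (c),
`Π_Ÿ(Π)` for the first line / Prop. 3.1 (ii)); a discrete rootable `Π`-module `A` (the model: `k̄ˣ ⊇ 𝒪_k̄^▷`,
`Π ↠ G_k` acting through Galois) with OPEN, FINITE-INDEX stabilisers (`hA`, `hfi`); and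
`c : CyclotomeCoefficients φ A' A` — a continuous `Π`-equivariant homomorphism `Λ(A) = μ_Ẑ(A) → A'`
(L2 `KummerContH1.lean`): at the model THIS is the composite cyclotomic rigidity isomorphism
`μ_Ẑ(O^×(G)) ⥲ μ_Ẑ(G) ⥲ (l·Δ_Θ)(Π)` of Cor. 1.11 (a), (b) p. 49 (resp. its composite with Cors. 2.8 (i), 2.9
towards `Π_μ(M^Θ_*)`, Prop. 3.1 (ii) p. 88) entering as a DATUM, bijective where needed.
CONSTRUCTED / PROVED:
* `kummerGmod` — the continuous Kummer class of `b ∈ A` at a level `K` with `H ⊓ K` fixing `b` (L2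
  `CyclotomeCoefficients.kummerContMap`), and `fmod_kummerGmod` — compatibility with the transition maps;
* `h1LimKummer c hA hfi : A →* Multiplicative (h1Lim φ A' H ⊥)` — **the Kummer map into the limit** (computed
  at the stabiliser of `b`), `h1LimKummer_eq_h1Of` — computable at ANY level fixing `b`, a HOMOMORPHISM;
* `h1LimConj_h1LimKummer` — **`Π`-EQUIVARIANCE** `h1LimConj σ (κ b) = κ (σ • b)` for `H` normal (L2
  `conj_kummerContClass_of_smul_eq` at the normal core of the level); packaged as
  `h1LimConjMulAut : Π →* MulAut (Multiplicative (h1Lim φ A' H ⊥))` with `h1LimKummer_smul`;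
* `h1LimKummer_injective_of_forall_isInvariant_eq_one` — **INJECTIVITY** ("`⊆`", "natural inclusion") when
  `c.hom` is bijective and NO `b ≠ 1` admits a compatible system of roots all fixed by some `H ⊓ K`, `K`
  finite-index open (the MLF input "`⋂ₙ (k′ˣ)ⁿ = 1`", cf. abc-iut-w4-d041's
  `h1LimRestrict_injective_of_forall_fixed_eq_one`): zero in the direct limit is zero at a finite level
  (`AddCommGroup.DirectLimit.of.zero_exact`), where L2's kernel theorem `kummerContClass_eq_one_iff` applies;
* `map_h1LimKummer_stable` — the image of a `Π`-stable submonoid `O ≤ A` (`𝒪_k̄^▷`) is stable under the action.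
The consumer theorems of `TemperedThetaMonoidsProofs3.lean` then yield both printed clauses of Prop. 3.1 (ii)
for the GENUINE ambient module, the only datum being `c`.  Typed ≠ any claim on [IUTchIII] Cor. 3.12.
-/

namespace Literature.IUT.HodgeArakelov

open Literature.AnabelianGeometry.EtaleTheta CohomologySystemOfContH1

noncomputable section

namespace CohomologySystemOfContH1

variable {P : TopGroup.{0}} {G' : Type} [Group G'] [TopologicalSpace G'] [IsTopologicalGroup G']
  (φ : P →* G') (A' : Subgroup G') [A'.Normal] [IsMulCommutative A'] (H : Subgroup P)
  {A : Type} [CommGroup A] [MulDistribMulAction P A] [TopologicalSpace A] [RootableBy A ℕ]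
  (c : CyclotomeCoefficients φ A' A)
  (hA : ∀ b : A, IsOpen (MulAction.stabilizer P b : Set P))

/-! ### Levels: the Kummer class of `b` in `H¹(H ⊓ K, A')` for a finite-index open `K` with `H ⊓ K` fixing `b` -/

omit [TopologicalSpace A] [RootableBy A ℕ] in
/-- If `K` fixes `b`, so does `H ⊓ K`. [cite: NeukirchSchmidtWingberg2008, I §5] -/
theorem mem_fixedPoints_inf_of_le {K : Subgroup P} {b : A} (hK : K ≤ MulAction.stabilizer P b) :
    b ∈ MulAction.fixedPoints ↥(H ⊓ K) A :=
  fun h => hK h.2.2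

/-- **The Kummer class of `b` at the level `K`** (`K ⊇ ⊥` finite-index open, `H ⊓ K` fixing `b`): the
continuous Kummer class `κ(b) ∈ H¹(H ⊓ K, A')` of L2's `CyclotomeCoefficients.kummerContMap` (coefficients changed
along `c : Λ(A) → A'`), as an element of the member `Gmod ⊥ K` of abc-iut-L6-t1's directed system.
[cite: Mochizuki2012, Prop 3.1 (ii) p.88] -/
def kummerGmod (i : Idx (P := P) ⊥) (b : A) (hb : b ∈ MulAction.fixedPoints ↥(H ⊓ i.K) A) :
    Gmod φ A' H ⊥ i :=
  Additive.ofMul (c.kummerContMap (H ⊓ i.K) hA ⟨b, hb⟩)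

/-- `kummerGmod` unfolded: the class of the Kummer cocycle of the canonical compatible root system.
[cite: LANA2026Report, §6.1 p.31] -/
theorem kummerGmod_eq (i : Idx (P := P) ⊥) (b : A) (hb : b ∈ MulAction.fixedPoints ↥(H ⊓ i.K) A) :
    kummerGmod φ A' H c hA i b hb =
      Additive.ofMul (c.kummerContClass (H ⊓ i.K) (RootSystem.ofRootableBy b) hb fun _ => hA _) :=
  congrArg Additive.ofMul (c.kummerContMap_apply_eq (H ⊓ i.K) hA ⟨b, hb⟩ (RootSystem.ofRootableBy b))

/-- `kummerGmod` computed with ANY compatible root system of `b`. [cite: LANA2026Report, §6.1 p.31] -/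
theorem kummerGmod_eq_of_rootSystem (i : Idx (P := P) ⊥) (b : A)
    (hb : b ∈ MulAction.fixedPoints ↥(H ⊓ i.K) A) (x : RootSystem b) :
    kummerGmod φ A' H c hA i b hb = Additive.ofMul (c.kummerContClass (H ⊓ i.K) x hb fun _ => hA _) :=
  congrArg Additive.ofMul (c.kummerContMap_apply_eq (H ⊓ i.K) hA ⟨b, hb⟩ x)

/-- `kummerGmod` is multiplicative (additively written) at a fixed level.
[cite: LANA2026Report, §6.1 p.31] -/
theorem kummerGmod_mul (i : Idx (P := P) ⊥) (b₁ b₂ : A)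
    (hb₁ : b₁ ∈ MulAction.fixedPoints ↥(H ⊓ i.K) A) (hb₂ : b₂ ∈ MulAction.fixedPoints ↥(H ⊓ i.K) A)
    (hb : b₁ * b₂ ∈ MulAction.fixedPoints ↥(H ⊓ i.K) A) :
    kummerGmod φ A' H c hA i (b₁ * b₂) hb = kummerGmod φ A' H c hA i b₁ hb₁ + kummerGmod φ A' H c hA i b₂ hb₂ := by
  have hmul : (⟨b₁ * b₂, hb⟩ : invariants (A := A) (H ⊓ i.K)) = ⟨b₁, hb₁⟩ * ⟨b₂, hb₂⟩ := rfl
  rw [kummerGmod, hmul, map_mul]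
  rfl

/-- `kummerGmod` of `1` is `0`. [cite: LANA2026Report, §6.1 p.31] -/
theorem kummerGmod_one (i : Idx (P := P) ⊥) (h1 : (1 : A) ∈ MulAction.fixedPoints ↥(H ⊓ i.K) A) :
    kummerGmod φ A' H c hA i 1 h1 = 0 := by
  have hone : (⟨1, h1⟩ : invariants (A := A) (H ⊓ i.K)) = 1 := rfl
  rw [kummerGmod, hone, map_one]
  rfl

omit [RootableBy A ℕ] in
/-- Restriction of a continuous Kummer class along `H₁ ≤ H₂` is the Kummer class at `H₁` (same cocycle,
restricted). [cite: NeukirchSchmidtWingberg2008, I §5] -/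
theorem res_kummerContClass {H₁ H₂ : Subgroup P} (h : H₁ ≤ H₂) {b : A} (x : RootSystem b)
    (hb₂ : b ∈ MulAction.fixedPoints H₂ A) (hb₁ : b ∈ MulAction.fixedPoints H₁ A)
    (hx : ∀ n : ℕ+, IsOpen (MulAction.stabilizer P (x.root n) : Set P)) :
    ContH1.res φ A' h (c.kummerContClass H₂ x hb₂ hx) = c.kummerContClass H₁ x hb₁ hx :=
  rfl

/-- **Compatibility with the transition maps**: restricting the level-`K_i` Kummer class to a smaller level
`K_j ⊆ K_i` gives the level-`K_j` Kummer class. [cite: Mochizuki2012, Prop 3.1 (ii) p.88] -/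
theorem fmod_kummerGmod {i j : Idx (P := P) ⊥} (hij : i ≤ j) (b : A)
    (hbi : b ∈ MulAction.fixedPoints ↥(H ⊓ i.K) A) (hbj : b ∈ MulAction.fixedPoints ↥(H ⊓ j.K) A) :
    fmod φ A' H ⊥ i j hij (kummerGmod φ A' H c hA i b hbi) = kummerGmod φ A' H c hA j b hbj := by
  rw [kummerGmod_eq, kummerGmod_eq]
  rfl

omit [TopologicalSpace A] [RootableBy A ℕ] in
/-- Monotonicity of being fixed: if `H ⊓ K_i` fixes `b` and `K_j ⊆ K_i` then `H ⊓ K_j` fixes `b`.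
[cite: NeukirchSchmidtWingberg2008, I §5] -/
theorem mem_fixedPoints_of_le {i j : Idx (P := P) ⊥} (hij : i ≤ j) {b : A}
    (hbi : b ∈ MulAction.fixedPoints ↥(H ⊓ i.K) A) : b ∈ MulAction.fixedPoints ↥(H ⊓ j.K) A :=
  fun h => hbi ⟨h.1, inf_le_inf_left H (Idx.le_iff.mp hij) h.2⟩

/-- In the limit, the Kummer class of `b` computed at two comparable levels agrees.
[cite: Mochizuki2012, Prop 3.1 (ii) p.88] -/
theorem h1Of_kummerGmod_eq_of_le {i j : Idx (P := P) ⊥} (hij : i ≤ j) (b : A)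
    (hbi : b ∈ MulAction.fixedPoints ↥(H ⊓ i.K) A) (hbj : b ∈ MulAction.fixedPoints ↥(H ⊓ j.K) A) :
    h1Of φ A' H ⊥ i (kummerGmod φ A' H c hA i b hbi) = h1Of φ A' H ⊥ j (kummerGmod φ A' H c hA j b hbj) := by
  rw [← fmod_kummerGmod φ A' H c hA hij b hbi hbj, h1Of_fmod]

/-- **Independence of the level**: the image in `lim_K H¹(H ⊓ K, A')` of the Kummer class of `b` does not
depend on the finite-index open level at which it is computed (the index set is directed).
[cite: Mochizuki2012, Prop 3.1 (ii) p.88] -/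
theorem h1Of_kummerGmod_eq (i j : Idx (P := P) ⊥) (b : A)
    (hbi : b ∈ MulAction.fixedPoints ↥(H ⊓ i.K) A) (hbj : b ∈ MulAction.fixedPoints ↥(H ⊓ j.K) A) :
    h1Of φ A' H ⊥ i (kummerGmod φ A' H c hA i b hbi) = h1Of φ A' H ⊥ j (kummerGmod φ A' H c hA j b hbj) := by
  haveI := Idx.isDirected (P := P) (⊥ : Subgroup P)
  obtain ⟨k, hik, hjk⟩ := directed_of (· ≤ ·) i j
  rw [h1Of_kummerGmod_eq_of_le φ A' H c hA hik b hbi (mem_fixedPoints_of_le H hik hbi),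
    h1Of_kummerGmod_eq_of_le φ A' H c hA hjk b hbj (mem_fixedPoints_of_le H hjk hbj)]

/-! ### The Kummer map into the limit -/

variable (hfi : ∀ b : A, (MulAction.stabilizer P b).FiniteIndex)

/-- The STABILISER of `b` as an index of the system over `⊥`: a finite-index open subgroup of `Π` (discrete
module: `hA`, `hfi`). [cite: Mochizuki2012, Prop 3.1 (ii) p.88] -/
def stabIdx (b : A) : Idx (P := P) ⊥ :=
  OrderDual.toDual ⟨MulAction.stabilizer P b, hfi b, hA b, bot_le⟩

omit [TopologicalSpace A] [RootableBy A ℕ] in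
/-- The subgroup of `stabIdx b` is the stabiliser. [cite: Mochizuki2012, Prop 3.1 (ii) p.88] -/
@[simp] theorem stabIdx_K (b : A) : (stabIdx hA hfi b).K = MulAction.stabilizer P b := rfl

omit [TopologicalSpace A] [RootableBy A ℕ] in
/-- `H ⊓ Stab(b)` fixes `b`. [cite: Mochizuki2012, Prop 3.1 (ii) p.88] -/
theorem mem_fixedPoints_stabIdx (b : A) : b ∈ MulAction.fixedPoints ↥(H ⊓ (stabIdx hA hfi b).K) A :=
  mem_fixedPoints_inf_of_le H le_rfl

/-- The Kummer map into the limit, as a bare function: `b ↦` the image of its level-`Stab(b)` Kummer class.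
[cite: Mochizuki2012, Prop 3.1 (ii) p.88] -/
def h1LimKummerFun (b : A) : h1Lim φ A' H ⊥ :=
  h1Of φ A' H ⊥ (stabIdx hA hfi b) (kummerGmod φ A' H c hA (stabIdx hA hfi b) b (mem_fixedPoints_stabIdx H hA hfi b))

/-- `h1LimKummerFun b` may be computed at ANY finite-index open level `K` with `H ⊓ K` fixing `b`.
[cite: Mochizuki2012, Prop 3.1 (ii) p.88] -/
theorem h1LimKummerFun_eq_h1Of (b : A) (i : Idx (P := P) ⊥) (hb : b ∈ MulAction.fixedPoints ↥(H ⊓ i.K) A) :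
    h1LimKummerFun φ A' H c hA hfi b = h1Of φ A' H ⊥ i (kummerGmod φ A' H c hA i b hb) :=
  h1Of_kummerGmod_eq φ A' H c hA _ _ b _ hb

/-- **The Kummer map of the discrete `Π`-module `A` into the genuine limit `lim_K H¹(H ⊓ K, A')`**, with
coefficients changed along `c : Λ(A) → A'`, as a HOMOMORPHISM — "`M_TM(M^Θ_*) ⊆ lim_J H¹(Π_Ÿ(M^Θ_*)|_J, Π_μ(M^Θ_*))`"
(Prop. 3.1 (ii)) / "`M^×_TM(Π) ↪ lim_J H¹(J, (l·Δ_Θ)(Π))`" (Cor. 1.12 (c)) on the whole of `A`; multiplicativity is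
checked at the common level `Stab(b₁) ∩ Stab(b₂)`. [cite: Mochizuki2012, Prop 3.1 (ii) p.88] -/
def h1LimKummer : A →* Multiplicative (h1Lim φ A' H ⊥) where
  toFun b := Multiplicative.ofAdd (h1LimKummerFun φ A' H c hA hfi b)
  map_one' := by
    rw [h1LimKummerFun, kummerGmod_one, map_zero]
    rfl
  map_mul' b₁ b₂ := by
    haveI := Idx.isDirected (P := P) (⊥ : Subgroup P)
    obtain ⟨k, h1k, h2k⟩ := directed_of (· ≤ ·) (stabIdx hA hfi b₁) (stabIdx hA hfi b₂)
    have hb₁ : b₁ ∈ MulAction.fixedPoints ↥(H ⊓ k.K) A :=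
      mem_fixedPoints_of_le H h1k (mem_fixedPoints_stabIdx H hA hfi b₁)
    have hb₂ : b₂ ∈ MulAction.fixedPoints ↥(H ⊓ k.K) A :=
      mem_fixedPoints_of_le H h2k (mem_fixedPoints_stabIdx H hA hfi b₂)
    have hb : b₁ * b₂ ∈ MulAction.fixedPoints ↥(H ⊓ k.K) A := fun h => by
      rw [smul_mul', hb₁ h, hb₂ h]
    rw [← ofAdd_add, h1LimKummerFun_eq_h1Of φ A' H c hA hfi (b₁ * b₂) k hb,
      h1LimKummerFun_eq_h1Of φ A' H c hA hfi b₁ k hb₁, h1LimKummerFun_eq_h1Of φ A' H c hA hfi b₂ k hb₂,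
      kummerGmod_mul φ A' H c hA k b₁ b₂ hb₁ hb₂ hb, map_add]

/-- `h1LimKummer` on elements. [cite: Mochizuki2012, Prop 3.1 (ii) p.88] -/
theorem h1LimKummer_apply (b : A) :
    h1LimKummer φ A' H c hA hfi b = Multiplicative.ofAdd (h1LimKummerFun φ A' H c hA hfi b) := rfl

/-- **`h1LimKummer b` computed at any level**: for every finite-index open `K` with `H ⊓ K` fixing `b`,
`κ(b)` is the image of the level-`K` continuous Kummer class `κ_K(b) ∈ H¹(H ⊓ K, A')`.
[cite: Mochizuki2012, Prop 3.1 (ii) p.88] -/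
theorem h1LimKummer_eq_h1Of (b : A) (i : Idx (P := P) ⊥) (hb : b ∈ MulAction.fixedPoints ↥(H ⊓ i.K) A) :
    h1LimKummer φ A' H c hA hfi b = Multiplicative.ofAdd (h1Of φ A' H ⊥ i (kummerGmod φ A' H c hA i b hb)) := by
  rw [h1LimKummer_apply, h1LimKummerFun_eq_h1Of φ A' H c hA hfi b i hb]

/-- The same with an arbitrary compatible root system of `b` at the level `K`.
[cite: LANA2026Report, §6.1 p.31] -/
theorem h1LimKummer_eq_h1Of_kummerContClass (b : A) (i : Idx (P := P) ⊥)
    (hb : b ∈ MulAction.fixedPoints ↥(H ⊓ i.K) A) (x : RootSystem b) :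
    h1LimKummer φ A' H c hA hfi b =
      Multiplicative.ofAdd (h1Of φ A' H ⊥ i
        (Additive.ofMul (c.kummerContClass (H ⊓ i.K) x hb fun _ => hA _))) := by
  rw [h1LimKummer_eq_h1Of φ A' H c hA hfi b i hb, kummerGmod_eq_of_rootSystem]

/-! ### `Π`-equivariance (`H` normal in `Π`) -/

section Equivariance

/-- At a level `K` with `H ⊓ K` NORMAL in `Π`, conjugation by `σ` carries the Kummer class of `b` to the Kummer
class of `σ • b` (L2's cocycle identity `conj_kummerContClass_of_smul_eq`).
[cite: NeukirchSchmidtWingberg2008, I §5] -/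
theorem conj_kummerGmod (σ : P) (i : Idx (P := P) ⊥) [(H ⊓ i.K).Normal] (b : A)
    (hb : b ∈ MulAction.fixedPoints ↥(H ⊓ i.K) A) (hσb : σ • b ∈ MulAction.fixedPoints ↥(H ⊓ i.K) A) :
    MonoidHom.toAdditive (ContH1.conj φ A' (H := H ⊓ i.K) σ) (kummerGmod φ A' H c hA i b hb) =
      kummerGmod φ A' H c hA i (σ • b) hσb := by
  rw [kummerGmod_eq, kummerGmod_eq_of_rootSystem φ A' H c hA i (σ • b) hσb ((RootSystem.ofRootableBy b).smul σ)]
  exact congrArg Additive.ofMul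
    (c.conj_kummerContClass_of_smul_eq (H ⊓ i.K) σ (RootSystem.ofRootableBy b)
      ((RootSystem.ofRootableBy b).smul σ) hb hσb (fun _ => hA _) (fun _ => hA _)
      (fun n => CyclotomeCoefficients.isOpen_stabilizer_smul_root σ _ (fun _ => hA _) n) rfl)

variable [H.Normal]

/-- **`Π`-EQUIVARIANCE of the Kummer map into the limit**: `h1LimConj σ (κ b) = κ (σ • b)` — "equipped with a
natural conjugation action by `Π_X(M^Θ_*)`" (Prop. 3.1 (ii)); "this map is `G`-equivariant with respect to the
natural action of `G` on `H¹`" ([cite: LANA2026Report, §6.1 p.31]).  Proof: pass to the NORMAL CORE of the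
stabiliser level (abc-iut-w4-d043's `conjAt`), where the previous lemma applies.
[cite: Mochizuki2012, Prop 3.1 (ii) p.88] -/
theorem h1LimConj_h1LimKummerFun (σ : P) (b : A) :
    h1LimConj φ A' H σ (h1LimKummerFun φ A' H c hA hfi b) = h1LimKummerFun φ A' H c hA hfi (σ • b) := by
  set i : Idx (P := P) ⊥ := stabIdx hA hfi b
  have hbi : b ∈ MulAction.fixedPoints ↥(H ⊓ i.K) A := mem_fixedPoints_stabIdx H hA hfi b
  have hbc : b ∈ MulAction.fixedPoints ↥(H ⊓ i.core.K) A := mem_fixedPoints_of_le H i.le_core hbi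
  have hσbc : σ • b ∈ MulAction.fixedPoints ↥(H ⊓ i.core.K) A :=
    CyclotomeCoefficients.smul_mem_fixedPoints_of_normal (H ⊓ i.core.K : Subgroup P) σ hbc
  rw [h1LimKummerFun_eq_h1Of φ A' H c hA hfi b i.core hbc, h1LimConj_of_normal,
    conj_kummerGmod φ A' H c hA σ i.core b hbc hσbc]
  exact (h1LimKummerFun_eq_h1Of φ A' H c hA hfi (σ • b) i.core hσbc).symm

/-- The same for the bundled homomorphism. [cite: Mochizuki2012, Prop 3.1 (ii) p.88] -/
theorem h1LimConj_h1LimKummer (σ : P) (b : A) :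
    h1LimConj φ A' H σ (Multiplicative.toAdd (h1LimKummer φ A' H c hA hfi b)) =
      Multiplicative.toAdd (h1LimKummer φ A' H c hA hfi (σ • b)) :=
  h1LimConj_h1LimKummerFun φ A' H c hA hfi σ b

/-- **The conjugation action of `Π` on the (multiplicatively written) limit as a `MulAut`-valued ACTION**
`Π →* MulAut (Multiplicative (lim_K H¹(H ⊓ K, A')))` — the shape `conj : Π →* MulAut H` of abc-iut-L6-t2's
`ThetaEnvData` — assembled from abc-iut-w4-d043's `h1LimConjEquiv` and its action laws.
[cite: Mochizuki2012, Prop 3.1 (ii) p.88] -/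
def h1LimConjMulAut : P →* MulAut (Multiplicative (h1Lim φ A' H ⊥)) where
  toFun σ := AddEquiv.toMultiplicative (h1LimConjEquiv φ A' H σ)
  map_one' := by
    refine MulEquiv.ext fun x => ?_
    change Multiplicative.ofAdd (h1LimConj φ A' H 1 (Multiplicative.toAdd x)) = x
    rw [h1LimConj_one_apply]
    rfl
  map_mul' σ τ := by
    refine MulEquiv.ext fun x => ?_
    change Multiplicative.ofAdd (h1LimConj φ A' H (σ * τ) (Multiplicative.toAdd x)) =
      Multiplicative.ofAdd (h1LimConj φ A' H σ
        (Multiplicative.toAdd (Multiplicative.ofAdd (h1LimConj φ A' H τ (Multiplicative.toAdd x)))))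
    rw [h1LimConj_mul_apply]
    rfl

/-- `h1LimConjMulAut σ` is `h1LimConj σ` transported to multiplicative notation.
[cite: Mochizuki2012, Prop 3.1 (ii) p.88] -/
theorem h1LimConjMulAut_apply (σ : P) (x : Multiplicative (h1Lim φ A' H ⊥)) :
    h1LimConjMulAut φ A' H σ x = Multiplicative.ofAdd (h1LimConj φ A' H σ (Multiplicative.toAdd x)) := rfl

/-- **Equivariance, `MulAut` form**: `κ (σ • b) = (h1LimConjMulAut σ) (κ b)` — the hypothesis shape `hκ` of the
consumer theorems of `TemperedThetaMonoidsProofs2/3.lean`. [cite: Mochizuki2012, Prop 3.1 (ii) p.88] -/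
theorem h1LimKummer_smul (σ : P) (b : A) :
    h1LimKummer φ A' H c hA hfi (σ • b) = h1LimConjMulAut φ A' H σ (h1LimKummer φ A' H c hA hfi b) := by
  rw [h1LimConjMulAut_apply, h1LimKummer_apply, h1LimKummer_apply, toAdd_ofAdd, h1LimConj_h1LimKummerFun]

/-- The image of a `Π`-STABLE submonoid `O ≤ A` (the constants `𝒪_k̄^▷`, or the units `𝒪_k̄^×`) under the
Kummer map is stable under the conjugation action on the limit — "`Ψ_cns(M^Θ_*)` … equipped with a natural
conjugation action by `Π_X(M^Θ_*)`". [cite: Mochizuki2012, Prop 3.1 (ii) p.88] -/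
theorem map_h1LimKummer_stable (O : Submonoid A) (hO : ∀ (σ : P) (b : A), b ∈ O → σ • b ∈ O) (σ : P)
    (y : Multiplicative (h1Lim φ A' H ⊥)) (hy : y ∈ O.map (h1LimKummer φ A' H c hA hfi)) :
    h1LimConjMulAut φ A' H σ y ∈ O.map (h1LimKummer φ A' H c hA hfi) := by
  obtain ⟨b, hb, rfl⟩ := hy
  exact ⟨σ • b, hO σ b hb, h1LimKummer_smul φ A' H c hA hfi σ b⟩

end Equivariance

/-! ### Injectivity ("`⊆`", "a natural inclusion") -/

/-- **Triviality at a level**: if `κ(b) = 1` in the LIMIT, then already at some finite-index open level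
`K ⊆ Stab(b)` the continuous Kummer class of `b` in `H¹(H ⊓ K, A')` is trivial (exactness of the direct limit at
a generator, Mathlib `AddCommGroup.DirectLimit.of.zero_exact`). [cite: NeukirchSchmidtWingberg2008, I §5] -/
theorem exists_kummerGmod_eq_zero_of_h1LimKummer_eq_one (b : A) (h1 : h1LimKummer φ A' H c hA hfi b = 1) :
    ∃ (j : Idx (P := P) ⊥) (hbj : b ∈ MulAction.fixedPoints ↥(H ⊓ j.K) A), kummerGmod φ A' H c hA j b hbj = 0 := by
  haveI := Idx.isDirected (P := P) (⊥ : Subgroup P)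
  haveI : Nonempty (Idx (P := P) ⊥) := ⟨Idx.top ⊥⟩
  haveI : DirectedSystem (Gmod φ A' H ⊥) fun i j hij => fmod φ A' H ⊥ i j hij := directedSystem φ A' H ⊥
  have h0 : h1Of φ A' H ⊥ (stabIdx hA hfi b)
      (kummerGmod φ A' H c hA (stabIdx hA hfi b) b (mem_fixedPoints_stabIdx H hA hfi b)) = 0 := by
    have := congrArg Multiplicative.toAdd h1
    rwa [h1LimKummer_apply, toAdd_ofAdd] at this
  obtain ⟨j, hij, hj⟩ := AddCommGroup.DirectLimit.of.zero_exact (G := Gmod φ A' H ⊥) (f := fmod φ A' H ⊥)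
    (stabIdx hA hfi b) _ h0
  refine ⟨j, mem_fixedPoints_of_le H hij (mem_fixedPoints_stabIdx H hA hfi b), ?_⟩
  rwa [fmod_kummerGmod φ A' H c hA hij b _ (mem_fixedPoints_of_le H hij (mem_fixedPoints_stabIdx H hA hfi b))]
    at hj

/-- If `κ(b) = 1` in the limit and the coefficient map `c : Λ(A) → A'` is BIJECTIVE, then `b` admits a compatible
system of roots ALL FIXED by `H ⊓ K` for some finite-index open `K` (L2's kernel theorem
`kummerContClass_eq_one_iff` at that level). [cite: LANA2026Report, §6.1 p.31] -/
theorem exists_isInvariant_of_h1LimKummer_eq_one (hc : Function.Bijective c.hom) (b : A)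
    (h1 : h1LimKummer φ A' H c hA hfi b = 1) :
    ∃ (j : Idx (P := P) ⊥) (y : RootSystem b), y.IsInvariant (H ⊓ j.K : Subgroup P) := by
  obtain ⟨j, hbj, hj⟩ := exists_kummerGmod_eq_zero_of_h1LimKummer_eq_one φ A' H c hA hfi b h1
  rw [kummerGmod_eq] at hj
  have hj' : c.kummerContClass (H ⊓ j.K) (RootSystem.ofRootableBy b) hbj (fun _ => hA _) = 1 :=
    Additive.ofMul.injective hj
  obtain ⟨y, hy⟩ := (c.kummerContClass_eq_one_iff (H ⊓ j.K) hc hA (RootSystem.ofRootableBy b) hbj).mp hj'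
  exact ⟨j, y, hy⟩

/-- **INJECTIVITY of the Kummer map into the limit** ("`Ψ_cns := M_TM ⊆ lim_J H¹(…)`", "a natural inclusion
`M^×_TM(Π) ↪ lim_J H¹(J, (l·Δ_Θ)(Π))`"): if the coefficient map `c` is bijective and no `b ≠ 1` admits a
compatible system of roots all fixed by `H ⊓ K`, `K` finite-index open (MLF model: such fixed points lie in a
finite `k′/k` and `⋂ₙ (k′ˣ)ⁿ = 1`, [AbsTopIII] Rmk. 1.5.4 (i)), then `κ` is injective. [cite: Mochizuki2012, Cor 1.12 p.56] -/
theorem h1LimKummer_injective_of_forall_isInvariant_eq_one (hc : Function.Bijective c.hom)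
    (hroots : ∀ (K : Subgroup P), K.FiniteIndex → IsOpen (K : Set P) →
      ∀ (b : A) (y : RootSystem b), y.IsInvariant (H ⊓ K : Subgroup P) → b = 1) :
    Function.Injective (h1LimKummer φ A' H c hA hfi) := by
  rw [injective_iff_map_eq_one]
  intro b hb
  obtain ⟨j, y, hy⟩ := exists_isInvariant_of_h1LimKummer_eq_one φ A' H c hA hfi hc b hb
  exact hroots j.K (OrderDual.ofDual j).2.1 (OrderDual.ofDual j).2.2.1 b y hy

/-- Conversely (no hypothesis on `c`): an element with a compatible system of roots all fixed by some `H ⊓ K`,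
`K` finite-index open, has trivial Kummer class in the limit — so the hypothesis of the previous theorem is also
NECESSARY for injectivity. [cite: LANA2026Report, §6.1 p.31] -/
theorem h1LimKummer_eq_one_of_isInvariant (b : A) (j : Idx (P := P) ⊥) (y : RootSystem b)
    (hy : y.IsInvariant (H ⊓ j.K : Subgroup P)) : h1LimKummer φ A' H c hA hfi b = 1 := by
  rw [h1LimKummer_eq_h1Of_kummerContClass φ A' H c hA hfi b j (hy.mem_fixedPoints _) y,
    c.kummerContClass_eq_one_of_isInvariant (H ⊓ j.K) y hy (hy.mem_fixedPoints _) _, ofMul_one, map_zero]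
  rfl

/-! ### The restriction of the Kummer map to a stable submonoid (the constants `𝒪^▷ ⊆ k̄ˣ`) -/

/-- **The Kummer map of a submonoid `O ≤ A` into the limit** (`𝒪_k̄^▷ ⊆ k̄ˣ`: "`Ψ_cns(M^Θ_*) := M_TM(M^Θ_*)`"),
the restriction of `h1LimKummer`. [cite: Mochizuki2012, Prop 3.1 (ii) p.88] -/
def h1LimKummerOn (O : Submonoid A) : O →* Multiplicative (h1Lim φ A' H ⊥) :=
  (h1LimKummer φ A' H c hA hfi).comp O.subtype

/-- `h1LimKummerOn` on elements. [cite: Mochizuki2012, Prop 3.1 (ii) p.88] -/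
@[simp] theorem h1LimKummerOn_apply (O : Submonoid A) (m : O) :
    h1LimKummerOn φ A' H c hA hfi O m = h1LimKummer φ A' H c hA hfi (m : A) := rfl

/-- The range of the restricted Kummer map is the image of `O`: "`Ψ_cns := M_TM`" as a submonoid of the
limit. [cite: Mochizuki2012, Prop 3.1 (ii) p.88] -/
theorem mrange_h1LimKummerOn (O : Submonoid A) :
    MonoidHom.mrange (h1LimKummerOn φ A' H c hA hfi O) = O.map (h1LimKummer φ A' H c hA hfi) := by
  rw [h1LimKummerOn, ← MonoidHom.map_mrange, Submonoid.mrange_subtype]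

/-- Injectivity passes to the restriction. [cite: Mochizuki2012, Prop 3.1 (ii) p.88] -/
theorem h1LimKummerOn_injective (O : Submonoid A) (hinj : Function.Injective (h1LimKummer φ A' H c hA hfi)) :
    Function.Injective (h1LimKummerOn φ A' H c hA hfi O) :=
  hinj.comp Subtype.val_injective

/-- **Equivariance of the restricted Kummer map** for the restricted action `σ • m` on a `Π`-stable `O` (the
hypothesis shape `hκ : ∀ σ m, κ (σ • m) = conj σ (κ m)` of the consumer theorems, with the action on `O` written
through `A`). [cite: Mochizuki2012, Prop 3.1 (ii) p.88] -/
theorem h1LimKummerOn_smul [H.Normal] (O : Submonoid A) (σ : P) (m m' : O) (h : ((m' : O) : A) = σ • (m : A)) :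
    h1LimKummerOn φ A' H c hA hfi O m' = h1LimConjMulAut φ A' H σ (h1LimKummerOn φ A' H c hA hfi O m) := by
  rw [h1LimKummerOn_apply, h1LimKummerOn_apply, h, h1LimKummer_smul]

end CohomologySystemOfContH1

end

end Literature.IUT.HodgeArakelov
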